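import Summits.ABC.IUTFork.Thm311RealInd1StripSignature
import Summits.ABC.IUTFork.Thm311RealInd1StripDegOne
import HarnessLib

/-!
# [IUTchIII] Theorem 3.11 (i) (Ind1), print-literal at `v ∈ 𝕍^non`: at a place of local degree one print's STRIP SLOT of
# the real signature EQUALS Dupuy–Hilado's (`Real.ind1Strip (analyticLogv F) v = Real.stripAutDH (inr v)`)

Proof-only record file (D-0012) of the abc-iut cell (seat abc-iut-c312-1, holder of record of the typed [IUTchIII] Thm.
3.11, gen 8); corollary sheet of `Thm311RealInd1StripSignature` (slot `Real.ind1Strip`, `Real.stripPrint`) and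
`Thm311RealInd1StripDegOne` (`Real.ind1StripOf_analyticLogv_eq_singleton_of_localDeg_eq_one`).  TAKES NO SIDE on
[IUTchIII] Cor. 3.12.

PROVED (ns `Summit.ABC.IUTFork.Thm311.Real`): `toAddEquiv_eq_refl_iff`; **`ind1Strip_analyticLogv_eq_stripAutDH_of_localDeg_eq_one`**
— at a finite place `v` with `localDeg F v = 1` (`K_v = ℚ_p`) print's (Ind1) strip slot for abc-iut-c312-5's canonical
analytic logarithm IS Dupuy–Hilado's trivialised slot `{1}` ([IUTchIII] Thm. 3.11 (i) (Ind1) p. 154 vs Dupuy–Hilado §4.7);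
`stripPrint_analyticLogv_eq_stripAutDH_of_localDeg_eq_one` (the same for the slot family `Real.stripPrint` at `inr v`).
Contrast `Thm311RealInd1StripNonVacuity` (`Real.ind1Strip_ne_stripAutDH_of_valPreserving`): at a place whose completion has
a non-trivial bicontinuous valuation-preserving automorphism the two slots DIFFER.  Nothing here asserts or refutes
[IUTchIII] Cor. 3.12; no side taken. [claim: Mochizuki2012, status: disputed]; [cite: DupuyHilado2025, §4.7].
-/

set_option autoImplicit false

noncomputable section

namespace Summit.ABC.IUTFork.Thm311.Real

open NumberField IsDedekindDomain Literature.IUT.LogVolume Literature.IUT.LogThetaLattice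
open Literature.NumberTheory.NumberFields

variable {F : Type} [Field F] [NumberField F] (v : HeightOneSpectrum (𝓞 F))

/-- A `ℚ`-linear automorphism of the carrier is the identity iff its additive part is. [folklore] -/
theorem toAddEquiv_eq_refl_iff (ψ : Carrier (.inr v : Place F) ≃ₗ[ℚ] Carrier (.inr v : Place F)) :
    (ψ.toAddEquiv : v.adicCompletion F ≃+ v.adicCompletion F) = AddEquiv.refl (v.adicCompletion F) ↔
      ψ = LinearEquiv.refl ℚ (Carrier (.inr v : Place F)) := by
  constructor
  · intro h
    apply LinearEquiv.ext
    intro x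
    exact AddEquiv.congr_fun h x
  · rintro rfl
    rfl

/-- **At a place of local degree one, print's (Ind1) strip slot for the analytic logarithm IS Dupuy–Hilado's `{1}`**:
`Real.ind1Strip (analyticLogv F) v = Real.stripAutDH (inr v)`. [cite: DupuyHilado2025, §4.7] [claim: Mochizuki2012, status: disputed] -/
theorem ind1Strip_analyticLogv_eq_stripAutDH_of_localDeg_eq_one (hdeg : localDeg F v = 1) :
    ind1Strip (analyticLogv F) v = stripAutDH (.inr v : Place F) := by
  ext ψ
  constructor
  · intro h
    have h1 : (ψ.toAddEquiv : v.adicCompletion F ≃+ v.adicCompletion F) ∈ ind1StripOf v (analyticLogv F v) := h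
    rw [ind1StripOf_analyticLogv_eq_singleton_of_localDeg_eq_one v hdeg] at h1
    have h2 : (ψ.toAddEquiv : v.adicCompletion F ≃+ v.adicCompletion F) = AddEquiv.refl (v.adicCompletion F) := h1
    have h3 : ψ = LinearEquiv.refl ℚ (Carrier (.inr v : Place F)) := (toAddEquiv_eq_refl_iff v ψ).mp h2
    exact h3
  · intro h
    have h3 : ψ = LinearEquiv.refl ℚ (Carrier (.inr v : Place F)) := h
    rw [h3]
    exact refl_mem_ind1Strip (analyticLogv F) v

/-- The same for the slot family: `Real.stripPrint (analyticLogv F) (inr v) = Real.stripAutDH (inr v)` at local degree one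
(at the infinite places the two families agree by definition). [cite: DupuyHilado2025, §4.7] [claim: Mochizuki2012, status: disputed] -/
theorem stripPrint_analyticLogv_eq_stripAutDH_of_localDeg_eq_one (hdeg : localDeg F v = 1) :
    stripPrint (analyticLogv F) (.inr v : Place F) = stripAutDH (.inr v : Place F) :=
  ind1Strip_analyticLogv_eq_stripAutDH_of_localDeg_eq_one v hdeg

/-- At the infinite places the two slot families agree by definition (the archimedean strip part is not typed by this
lineage). [folklore] -/
theorem stripPrint_inl_eq (logv : PadicLogs F) (w : InfinitePlace F) :
    stripPrint logv (.inl w : Place F) = stripAutDH (.inl w : Place F) := rfl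

end Summit.ABC.IUTFork.Thm311.Real

end
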